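import Literature.Geometry.Riemannian.KernelNashEntropyPole
import HarnessLib

/-!
# The pointed Nash entropy of the conjugate heat kernel is monotone (Bamler 2020a, Prop. 5.2)

R. Bamler, *Entropy and heat kernel bounds on a Ricci flow background*, arXiv:2008.07093 (2020a),
§5.1, Prop. 5.2: for the conjugate heat kernel `dν_{x₀,t₀;s} = K(x₀,t₀;·,s) dg_s` of a Ricci flow
on a closed manifold, `d/dτ 𝒩_{x₀,t₀}(τ) ≤ 0`, i.e. `τ ↦ 𝒩_{x₀,t₀}(τ)` is non-increasing and
`s ↦ 𝒩*_s(x₀,t₀) = 𝒩_{x₀,t₀}(t₀ − s)` is non-decreasing in the forward time `s < t₀`.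

* `kernelNashEntropy_mono` — `𝒩(s₁) ≤ 𝒩(s₂)` for `a < s₁ ≤ s₂ < t₀ ≤ T`, where
  `𝒩(r) = pointedNashEntropy h (fun r y ↦ K (y, r)) m t₀ r` and `K = hflow.heatKernelFn hh hR t₀ x₀`
  (`RicciFlowHeatKernelFn.lean`), for a Ricci flow `hflow = (h, cov)` on `[a, T]` of a `C^∞` family
  of Riemannian metrics on a closed connected manifold modelled on `ℝᵐ`, `m ≥ 3`.

Proof, from the tree's Prop. 5.2 bricks (`KernelNashEntropy.lean`, `KernelNashEntropyPole.lean`):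
the concavity sandwich `(t₀ − s₁)𝒩(s₁) − (t₀ − s₂)𝒩(s₂) = ∫_{s₁}^{s₂} 𝒲 ≤ (s₂ − s₁)𝒲(s₂)`
(`IsRicciFlow.mul_kernelWEntropy_le_and_le`, `𝒲` non-decreasing in `s`) and `𝒲(s₂) ≤ 𝒩(s₂)`
(`IsRicciFlow.kernelWEntropy_le_kernelNashEntropy`, which rests on `τ𝒩(τ) → 0` at the pole) give
`(t₀ − s₁)𝒩(s₁) ≤ (t₀ − s₁)𝒩(s₂)`.

What is NOT here: the differential form `d/dτ 𝒩_{x₀,t₀}(τ) = (𝒲 − 𝒩)/τ ≤ 0` as a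
derivative statement, and the quantitative bounds (5.6), (5.7) of Bamler's §5. Everything is
proved; no definitions, no named facts.

## References

* R. H. Bamler, *Entropy and heat kernel bounds on a Ricci flow background*, arXiv:2008.07093
  (2020), §5.1, Def. 5.1, Prop. 5.2. [Bamler2020Entropy]
-/

noncomputable section

open Bundle Set Function Filter Manifold MeasureTheory Measure TopologicalSpace
open scoped Manifold ContDiff Topology ENNReal NNReal

namespace Literature.Geometry.Riemannian

open Lorentzian Lorentzian.PseudoRiemannianMetric

section Mono

variable {m : ℕ} {H : Type*} [TopologicalSpace H]
  {I : ModelWithCorners ℝ (EuclideanSpace ℝ (Fin m)) H} [I.Boundaryless]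
  {M : Type*} [TopologicalSpace M] [ChartedSpace H M] [IsManifold I ∞ M]
  [T2Space M] [CompactSpace M] [SecondCountableTopology M] [MeasurableSpace M] [BorelSpace M]
  [PreconnectedSpace M]
  {h : ℝ → PseudoRiemannianMetric I ∞ (EuclideanSpace ℝ (Fin m)) (TangentSpace I : M → Type _)}
  {cov : ℝ → CovariantDerivative I (EuclideanSpace ℝ (Fin m)) (TangentSpace I : M → Type _)}
  {a T : ℝ}

/-- **The pointed Nash entropy of the conjugate heat kernel is non-decreasing in forward time**
(Bamler 2020a, Prop. 5.2: `d/dτ 𝒩_{x₀,t₀}(τ) ≤ 0`, i.e. `s ↦ 𝒩*_s(x₀,t₀)` is non-decreasing):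
for the kernel `K = K(x,t;·,·)` of a Ricci flow on `[a, T]` (closed connected manifold, `m ≥ 3`)
and `a < s₁ ≤ s₂ < t ≤ T`, `𝒩(s₁) ≤ 𝒩(s₂)` with
`𝒩(r) = pointedNashEntropy h (fun r y ↦ K (y, r)) m t r = 𝒩_{x,t}(t − r)`.
[cite: Bamler2020Entropy, §5.1, Prop. 5.2] -/
theorem kernelNashEntropy_mono (hflow : IsRicciFlow h cov (Icc a T))
    (hh : IsContMDiffFamilyOn ∞ h univ) (hR : ∀ r, (h r).IsRiemannian) (hm : 3 ≤ m)
    {s₁ s₂ t : ℝ} (hs₁ : a < s₁) (h12 : s₁ ≤ s₂) (hs₂ : s₂ < t) (ht : t ≤ T) (x : M) :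
    pointedNashEntropy h (fun r y ↦ hflow.heatKernelFn hh hR t x (y, r)) m t s₁ ≤
      pointedNashEntropy h (fun r y ↦ hflow.heatKernelFn hh hR t x (y, r)) m t s₂ := by
  rcases h12.eq_or_lt with rfl | h12'
  · exact le_rfl
  have ht' : t ∈ Ioc a T := ⟨(hs₁.trans_le h12).trans hs₂, ht⟩
  have hs₂' : s₂ ∈ Ioo a t := ⟨hs₁.trans_le h12, hs₂⟩
  have hflow' : IsRicciFlow h cov (Icc s₁ s₂) :=
    hflow.mono (Icc_subset_Icc hs₁.le (hs₂.le.trans ht))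
  -- `(t − s₁)𝒩(s₁) − (t − s₂)𝒩(s₂) ≤ (s₂ − s₁)𝒲(s₂)` (concavity of `τ𝒩(τ)`)
  have hsand := (hflow'.mul_kernelWEntropy_le_and_le hh hR
    (hflow.heatKernelFn_contMDiffOn hh hR ht' x)
    (fun p hp ↦ hflow.heatKernelFn_pos hh hR ht' x hp)
    (fun s hs ↦ hflow.heatKernelMeasure_eq_withDensity_heatKernelFn hh hR ht' x hs)
    (fun p hp ↦ hflow.deriv_heatKernelFn_time hh hR ht' x hp) hs₁ h12' hs₂).2
  -- `𝒲(s₂) ≤ 𝒩(s₂)`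
  have hWN := hflow.kernelWEntropy_le_kernelNashEntropy hh hR hm ht' x hs₂'
  have h3 := mul_le_mul_of_nonneg_left hWN (sub_nonneg.2 h12)
  exact le_of_mul_le_mul_left (by linarith) (sub_pos.2 (h12.trans_lt hs₂))

end Mono

end Literature.Geometry.Riemannian

end
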